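import Mathlib
import Summits.CriticalPhenomena.PercolationContinuityZ3.Theorems.PercNearOneGluingNoHeavyLowerTailBlockStarGluing
import Summits.CriticalPhenomena.PercolationContinuityZ3.Theorems.PercNearOneGluingNoHeavyLowerTailBlockOffSetTransfer
import Summits.CriticalPhenomena.PercolationContinuityZ3.Theorems.PercNearOneGluingNoHeavyLowerTailBlockLayerDecomposition
import Summits.CriticalPhenomena.PercolationContinuityZ3.Theorems.PercNearOneGluingAdditiveGluingPartial
import Literature.Probability.LatticeModels.ProdBernoulliCoupling
import HarnessLib

/-!
# Crux `PercNearOneGluing.NoHeavyLowerTail` (stmt-CriticalPhenomena-4575), line `bhk-superadditivity-thinning` —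
# POCKET-SIZE GLUING: Kozma–Nitzan's Conjecture 3 on the class of observers with a bounded relay-free region

Lead prover-line-stmt-CriticalPhenomena-4575-c5-0, 2026-08-16.  Proves the registered stub
`pocketSizeGluing_block` (block form); the vertex form `pocketSizeGluing` and the corollary
`nearOneGluing_of_pocketSize` are in the companion file `…PocketSizeGluingVertex.lean`.  Lands with
`--supports stmt-CriticalPhenomena-4575`.

## The theorem

Finite weighted graph on `Fin n` (weights `w`), relay set `A ∋ b`, observer `o ∉ A`.  Let `F ∌ o` be any
finite vertex set, disjoint from `A`, such that every positive-weight pair with one endpoint in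
`{o} ∪ F` has its other endpoint in `{o} ∪ F ∪ A` (for instance the `A`-free component of `o`: all
vertices joined to `o` by a positive-weight path avoiding `A`).  Then, with `μ = prodBernoulli w`,

  `(μ(o ↔ A) − μ(o ↔ b)) ^ (|F| + 1) ≤ max_{a ∈ A} μ(a ↮ b)`, and, for `F ≠ ∅`,
  `(μ(o ↔ A) − μ(o ↔ b)) ^ |F| · μ(o ↮ b) ≤ max_{a ∈ A} μ(a ↮ b)`                     (`pocketSizeGluing`)

(stated with a slack parameter `t ≥ μ(a ↮ b)` for all `a ∈ A`).  Consequently (`nearOneGluing_of_pocketSize`)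
`NearOneGluing` — Kozma–Nitzan's Conjecture 3 (arXiv:2401.12397 p. 15), equivalent to this crux — holds on
the class `{|F| ≤ m}` with the explicit `δ = (ε/2)^(m+1)`, for every `m`, UNIFORMLY in `|A|` and `n`.
Kozma–Nitzan's Theorem 4 is the case `m = 0` and their Theorem 5 the case `m = 1` (both with the linear
rate); for `m ≥ 2`, i.e. observers with several private non-relay neighbours or deeper buffers, nothing
was available (the goodness recursion of KN Thm 5 does not close when a layer has two low vertices — the
open hypothesis HT of crux 4576).  The price of the present argument is the polynomial rate `δ^{1/(m+1)}`.

## Proof (block form `pocketSizeGluing_block`, strong induction on `|F|`)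

Work with an observer BLOCK `O` contracted (`μ = prodBernoulli (glue w O)`), `u := μ(O ↮ b)`,
`bad := μ(O ↔ A) − μ(O ↔ b) ∈ [0, u]`, and the block-deleted deadness `d_a := P_{kill w O}(a ↮ b)`.
* Layer decomposition (`blockLayerDecomposition`, KN's σ-recursion in block form):
  `bad = Σ_S μ(L_S) · bad'_S`, `bad'_S := P'_S(S ↔ A) − P'_S(S ↔ b)`, `P'_S = prodBernoulli (glue (kill w O) S)`,
  summed over the values `S` of the open layer of `O`; `μ(L_S) > 0` only for positive layers.
* Relays only get deader: `P'_S(a ↮ b) ≤ d_a` (monotone coupling, `pocketGlue_compl_mono`), and the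
  OFF-SET TRANSFER (Harris; `blockOffSetTransfer`) `d_a · u ≤ μ(a ↮ b) ≤ t`; put `c := max_a d_a`.
* A layer meeting `A` at `v`: `bad'_S ≤ P'_S(v ↮ b) ≤ c`.  A non-empty layer avoiding `A` lies in `F`
  (closure), and `(kill w O, S, F ∖ S)` is an instance of the same kind with fewer free vertices and
  relay bound `c`; by induction `bad'_S ^ (|F ∖ S| + 1) ≤ c`.  In all cases `0 ≤ bad'_S ≤ 1` and
  `bad'_S ^ |F| ≤ c`.
* Hence `bad ≤ max_S bad'_S =: γ` (a convex combination) and `bad ^ |F| ≤ γ ^ |F| ≤ c`, so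
  `bad ^ |F| · u ≤ c · u ≤ t`; finally `bad ≤ u` gives `bad ^ (|F|+1) ≤ t`.  The base `F = ∅` is the
  star-attached block, `bad ≤ t` (`blockStarGluing`, KN Thm 4 in block form).

No new definitions: `glue w O = fun e => if (∀ x ∈ e, x ∈ O) ∧ ¬ e.IsDiag then 1 else w e`,
`kill w O = fun e => if (∃ x ∈ e, x ∈ O) then 0 else w e` are written out, as in crux 4576's files.
-/

namespace Summit.CriticalPhenomena.PercolationContinuityZ3.Theorems

open MeasureTheory Set
open Literature.Probability.LatticeModels (prodBernoulli prodBernoulli_real_mono_of_isUpperSet)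
open Literature.Probability.Percolation (BondConfig openConn isUpperSet_openConn)

noncomputable section
open Classical

variable {n : ℕ}

/-! ### Small tools -/

/-- Every event of bond configurations on `Fin n` is measurable. [folklore] -/
theorem pocketGlue_measurableSet (E : Set (BondConfig (Fin n))) : MeasurableSet E :=
  E.toFinite.measurableSet

/-- Gluing a layer only makes relays more reliable: for the block-deleted weights
`k = kill w O` and any `S`, `P_{glue k S}(a ↮ b) ≤ P_k(a ↮ b)` (monotone coupling, the event
`{a ↔ b}` being increasing). [folklore] -/
theorem pocketGlue_compl_mono (w : Sym2 (Fin n) → unitInterval) (O S : Finset (Fin n)) (a b : Fin n) :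
    (prodBernoulli (fun e : Sym2 (Fin n) => if (∀ x ∈ e, x ∈ S) ∧ ¬ e.IsDiag then 1 else
        if (∃ x ∈ e, x ∈ O) then 0 else w e)).real (openConn a b)ᶜ ≤
      (prodBernoulli (fun e : Sym2 (Fin n) => if (∃ x ∈ e, x ∈ O) then 0 else w e)).real
        (openConn a b)ᶜ := by
  have hle : (fun e : Sym2 (Fin n) => if (∃ x ∈ e, x ∈ O) then (0 : unitInterval) else w e) ≤
      (fun e : Sym2 (Fin n) => if (∀ x ∈ e, x ∈ S) ∧ ¬ e.IsDiag then 1 else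
        if (∃ x ∈ e, x ∈ O) then 0 else w e) := by
    intro e
    show (if (∃ x ∈ e, x ∈ O) then (0 : unitInterval) else w e) ≤
      (if (∀ x ∈ e, x ∈ S) ∧ ¬ e.IsDiag then 1 else if (∃ x ∈ e, x ∈ O) then 0 else w e)
    by_cases h1 : (∀ x ∈ e, x ∈ S) ∧ ¬ e.IsDiag
    · rw [if_pos h1]
      exact unitInterval.le_one'
    · rw [if_neg h1]
  have hmono := prodBernoulli_real_mono_of_isUpperSet hle (isUpperSet_openConn a b)
    (pocketGlue_measurableSet _)
  rw [probReal_compl_eq_one_sub (pocketGlue_measurableSet _),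
    probReal_compl_eq_one_sub (pocketGlue_measurableSet _)]
  linarith

/-- The event "no vertex of the block reaches `b`" is the complement of `{O ↔ b}`. -/
theorem pocketGlue_forall_notMem_eq (O : Finset (Fin n)) (b : Fin n) :
    {ω : BondConfig (Fin n) | ∀ o ∈ O, ω ∉ openConn o b} = (⋃ o ∈ O, openConn o b)ᶜ := by
  ext ω
  simp only [Set.mem_setOf_eq, Set.mem_compl_iff, Set.mem_iUnion, exists_prop, not_exists, not_and]

/-- `{O ↔ b} ⊆ {O ↔ A}` when `b ∈ A`. -/
theorem pocketGlue_reach_b_subset (O A : Finset (Fin n)) {b : Fin n} (hbA : b ∈ A) :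
    (⋃ o ∈ O, openConn o b : Set (BondConfig (Fin n))) ⊆ ⋃ o ∈ O, ⋃ x ∈ A, openConn o x := by
  intro ω hω
  simp only [Set.mem_iUnion, exists_prop] at hω ⊢
  obtain ⟨o, ho, hob⟩ := hω
  exact ⟨o, ho, b, hbA, hob⟩

/-- A convex combination is bounded by the largest of its terms with non-zero weight:
if `ℓ ≥ 0`, `Σ ℓ = 1` and `x S ≤ γ` whenever `ℓ S ≠ 0`, then `Σ ℓ S · x S ≤ γ`. -/
theorem pocketGlue_convex_le {ι : Type*} (s : Finset ι) (ℓ x : ι → ℝ) (γ : ℝ)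
    (hℓ : ∀ S ∈ s, 0 ≤ ℓ S) (hone : ∑ S ∈ s, ℓ S = 1) (hx : ∀ S ∈ s, ℓ S ≠ 0 → x S ≤ γ) :
    ∑ S ∈ s, ℓ S * x S ≤ γ := by
  calc ∑ S ∈ s, ℓ S * x S ≤ ∑ S ∈ s, ℓ S * γ := by
        refine Finset.sum_le_sum fun S hS => ?_
        rcases eq_or_ne (ℓ S) 0 with h0 | h0
        · simp [h0]
        · exact mul_le_mul_of_nonneg_left (hx S hS h0) (hℓ S hS)
    _ = γ := by rw [← Finset.sum_mul, hone, one_mul]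

/-! ### The base: a star-attached block -/

/-- **Base case** (`F = ∅`): for a star-attached contracted block, `bad ≤ t` — `blockStarGluing`
(KN Thm 4, block form) with the relay hypothesis converted from `μ(a ↮ b) ≤ t`. -/
theorem pocketGlue_base (w : Sym2 (Fin n) → unitInterval) (O A : Finset (Fin n)) (b : Fin n) (t : ℝ)
    (hbA : b ∈ A) (hOA : Disjoint O A)
    (hiso : ∀ x ∈ O, ∀ y : Fin n, y ∉ O → y ∉ A → w s(x, y) = 0)
    (hrel : ∀ a ∈ A, (prodBernoulli (fun e : Sym2 (Fin n) =>
      if (∀ x ∈ e, x ∈ O) ∧ ¬ e.IsDiag then 1 else w e)).real (openConn a b)ᶜ ≤ t) :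
    (prodBernoulli (fun e : Sym2 (Fin n) => if (∀ x ∈ e, x ∈ O) ∧ ¬ e.IsDiag then 1 else w e)).real
        (⋃ o ∈ O, ⋃ x ∈ A, openConn o x) -
      (prodBernoulli (fun e : Sym2 (Fin n) => if (∀ x ∈ e, x ∈ O) ∧ ¬ e.IsDiag then 1 else w e)).real
        (⋃ o ∈ O, openConn o b) ≤ t := by
  have ht : 0 ≤ t := by
    have h := hrel b hbA
    have huniv : (openConn b b : Set (BondConfig (Fin n))) = Set.univ :=
      Set.eq_univ_of_forall fun _ => SimpleGraph.Reachable.refl _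
    rw [huniv, Set.compl_univ, measureReal_empty] at h
    exact h
  have hrel' : ∀ a ∈ A, 1 - t ≤ (prodBernoulli (fun e : Sym2 (Fin n) =>
      if (∀ x ∈ e, x ∈ O) ∧ ¬ e.IsDiag then 1 else w e)).real (openConn a b) := by
    intro a ha
    have h := hrel a ha
    rw [probReal_compl_eq_one_sub (pocketGlue_measurableSet _)] at h
    linarith
  have key := blockStarGluing n w O A b t hOA hbA hiso ht hrel'
  linarith

/-! ### The step: peel the layer of the block and pay with the off-set transfer -/

/-- **Inductive step.**  For a contracted block `O` with a NON-EMPTY free region `F` (closed under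
positive-weight non-relay adjacency from `O ∪ F`), granted the weak inequality
`bad' ^ (|F'| + 1) ≤ t'` for every instance on the same vertex set with fewer free vertices, one has
the strong inequality `bad ^ |F| · μ(O ↮ b) ≤ t`. -/
theorem pocketGlue_step (w : Sym2 (Fin n) → unitInterval) (O F A : Finset (Fin n)) (b : Fin n) (t : ℝ)
    (hbA : b ∈ A) (hOA : Disjoint O A) (hFA : Disjoint F A) (hFne : F.Nonempty)
    (hcl : ∀ x ∈ O ∪ F, ∀ y : Fin n, y ∉ O → y ∉ F → y ∉ A → w s(x, y) = 0)
    (hrel : ∀ a ∈ A, (prodBernoulli (fun e : Sym2 (Fin n) =>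
      if (∀ x ∈ e, x ∈ O) ∧ ¬ e.IsDiag then 1 else w e)).real (openConn a b)ᶜ ≤ t)
    (IH : ∀ (w' : Sym2 (Fin n) → unitInterval) (O' F' : Finset (Fin n)) (t' : ℝ), F'.card < F.card →
      Disjoint O' A → Disjoint F' A → Disjoint O' F' →
      (∀ x ∈ O' ∪ F', ∀ y : Fin n, y ∉ O' → y ∉ F' → y ∉ A → w' s(x, y) = 0) →
      (∀ a ∈ A, (prodBernoulli (fun e : Sym2 (Fin n) =>
        if (∀ x ∈ e, x ∈ O') ∧ ¬ e.IsDiag then 1 else w' e)).real (openConn a b)ᶜ ≤ t') →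
      ((prodBernoulli (fun e : Sym2 (Fin n) =>
          if (∀ x ∈ e, x ∈ O') ∧ ¬ e.IsDiag then 1 else w' e)).real (⋃ o ∈ O', ⋃ x ∈ A, openConn o x) -
        (prodBernoulli (fun e : Sym2 (Fin n) =>
          if (∀ x ∈ e, x ∈ O') ∧ ¬ e.IsDiag then 1 else w' e)).real (⋃ o ∈ O', openConn o b))
          ^ (F'.card + 1) ≤ t') :
    ((prodBernoulli (fun e : Sym2 (Fin n) => if (∀ x ∈ e, x ∈ O) ∧ ¬ e.IsDiag then 1 else w e)).real
          (⋃ o ∈ O, ⋃ x ∈ A, openConn o x) -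
        (prodBernoulli (fun e : Sym2 (Fin n) => if (∀ x ∈ e, x ∈ O) ∧ ¬ e.IsDiag then 1 else w e)).real
          (⋃ o ∈ O, openConn o b)) ^ F.card *
      (prodBernoulli (fun e : Sym2 (Fin n) => if (∀ x ∈ e, x ∈ O) ∧ ¬ e.IsDiag then 1 else w e)).real
        {ω : BondConfig (Fin n) | ∀ o ∈ O, ω ∉ openConn o b} ≤ t := by
  have hbO : b ∉ O := fun h => Finset.disjoint_left.1 hOA h hbA
  have hFc : F.card ≠ 0 := Finset.card_ne_zero.2 hFne
  -- names
  set g : Sym2 (Fin n) → unitInterval :=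
    fun e => if (∀ x ∈ e, x ∈ O) ∧ ¬ e.IsDiag then 1 else w e with hg
  set k : Sym2 (Fin n) → unitInterval := fun e => if (∃ x ∈ e, x ∈ O) then 0 else w e with hk
  set q : Finset (Fin n) → Sym2 (Fin n) → unitInterval := fun S e =>
    if (∀ x ∈ e, x ∈ S) ∧ ¬ e.IsDiag then 1 else if (∃ x ∈ e, x ∈ O) then 0 else w e with hq
  set ℓ : Finset (Fin n) → ℝ := fun S => (prodBernoulli g).real
    {ω : BondConfig (Fin n) | ∀ x : Fin n, x ∈ S ↔ (x ∉ O ∧ ∃ o ∈ O, s(o, x) ∈ ω)} with hℓ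
  set α : Finset (Fin n) → ℝ := fun S => (prodBernoulli (q S)).real
    (⋃ s ∈ S, ⋃ x ∈ A, openConn s x) with hα
  set β : Finset (Fin n) → ℝ := fun S => (prodBernoulli (q S)).real (⋃ s ∈ S, openConn s b) with hβ
  set d : Fin n → ℝ := fun a => (prodBernoulli k).real (openConn a b)ᶜ with hd
  -- the layer decomposition
  obtain ⟨hone, hpos, hAsum, hbsum, -⟩ := blockLayerDecomposition n w O A b b hOA hbO hbO
  change ∑ S : Finset (Fin n), ℓ S = 1 at hone
  change ∀ S : Finset (Fin n), ℓ S ≠ 0 → ∀ x ∈ S, x ∉ O ∧ ∃ o ∈ O, w s(o, x) ≠ 0 at hpos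
  change (prodBernoulli g).real (⋃ o ∈ O, ⋃ x ∈ A, openConn o x) =
    ∑ S : Finset (Fin n), ℓ S * α S at hAsum
  change (prodBernoulli g).real (⋃ o ∈ O, openConn o b) = ∑ S : Finset (Fin n), ℓ S * β S at hbsum
  -- the worst block-deleted deadness `c`
  obtain ⟨aM, haM, hmax⟩ := Finset.exists_max_image A d ⟨b, hbA⟩
  set c : ℝ := d aM with hc
  have hc0 : 0 ≤ c := measureReal_nonneg
  have haMO : aM ∉ O := fun h => Finset.disjoint_left.1 hOA h haM
  -- off-set transfer: `c · u ≤ μ(aM ↮ b) ≤ t`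
  have htrans : c * (prodBernoulli g).real {ω : BondConfig (Fin n) | ∀ o ∈ O, ω ∉ openConn o b} ≤ t :=
    le_trans (blockOffSetTransfer n w O aM b haMO hbO) (hrel aM haM)
  -- every sub-block has unreliabilities at most `c`
  have hsub : ∀ (S : Finset (Fin n)) (a : Fin n), a ∈ A →
      (prodBernoulli (q S)).real (openConn a b)ᶜ ≤ c :=
    fun S a ha => le_trans (pocketGlue_compl_mono w O S a b) (hmax a ha)
  -- termwise bounds
  have hterm : ∀ S : Finset (Fin n), ℓ S ≠ 0 → 0 ≤ α S - β S ∧ α S - β S ≤ 1 ∧ (α S - β S) ^ F.card ≤ c := by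
    intro S hS0
    have hS := hpos S hS0
    have hβα : β S ≤ α S :=
      measureReal_mono (pocketGlue_reach_b_subset S A hbA) (measure_ne_top _ _)
    have hα1 : α S ≤ 1 := measureReal_le_one
    have hβ0 : 0 ≤ β S := measureReal_nonneg
    have h0 : 0 ≤ α S - β S := by linarith
    have h1 : α S - β S ≤ 1 := by linarith
    refine ⟨h0, h1, ?_⟩
    by_cases hSA : (S ∩ A).Nonempty
    · -- a layer meeting `A` at `v`: `bad'_S ≤ P'(v ↮ b) ≤ c`
      obtain ⟨v, hv⟩ := hSA
      rw [Finset.mem_inter] at hv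
      have hvb : 1 - β S ≤ (prodBernoulli (q S)).real (openConn v b)ᶜ := by
        rw [probReal_compl_eq_one_sub (pocketGlue_measurableSet _)]
        have : (prodBernoulli (q S)).real (openConn v b) ≤ β S :=
          measureReal_mono (fun ω hω => Set.mem_iUnion₂.2 ⟨v, hv.1, hω⟩) (measure_ne_top _ _)
        linarith
      have hle : α S - β S ≤ c := by linarith [hsub S v hv.2]
      exact le_trans (pow_le_of_le_one h0 h1 hFc) hle
    · have hSA' : Disjoint S A :=
        Finset.disjoint_iff_inter_eq_empty.2 (Finset.not_nonempty_iff_eq_empty.1 hSA)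
      by_cases hSe : S = ∅
      · -- the empty layer contributes nothing
        subst hSe
        have hα0 : α ∅ = 0 := by simp [hα]
        have hβ0' : β ∅ = 0 := by simp [hβ]
        rw [hα0, hβ0', sub_zero, zero_pow hFc]
        exact hc0
      · -- a non-empty layer avoiding `A`: it lies in `F`, recurse on `(kill w O, S, F \ S)`
        have hSne : S.Nonempty := Finset.nonempty_iff_ne_empty.2 hSe
        have hSF : S ⊆ F := by
          intro x hxS
          obtain ⟨hxO, o, ho, hw⟩ := hS x hxS
          by_contra hxF
          have hxA : x ∉ A := fun h => Finset.disjoint_left.1 hSA' hxS h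
          exact hw (hcl o (Finset.mem_union_left F ho) x hxO hxF hxA)
        have hSO : Disjoint S O := by
          refine Finset.disjoint_left.2 fun x hxS hxO => ?_
          exact (hS x hxS).1 hxO
        have hcard : (F \ S).card < F.card := by
          rw [Finset.card_sdiff_of_subset hSF]
          have : 0 < S.card := Finset.card_pos.2 hSne
          have : S.card ≤ F.card := Finset.card_le_card hSF
          omega
        have hFA' : Disjoint (F \ S) A := Finset.disjoint_of_subset_left Finset.sdiff_subset hFA
        have hSF' : Disjoint S (F \ S) := Finset.disjoint_sdiff
        have hcl' : ∀ x ∈ S ∪ (F \ S), ∀ y : Fin n, y ∉ S → y ∉ F \ S → y ∉ A → k s(x, y) = 0 := by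
          intro x hx y hyS hyFS hyA
          simp only [hk]
          split_ifs with hxy
          · rfl
          · push Not at hxy
            have hxO : x ∉ O := fun h => hxy x (Sym2.mem_mk_left x y) h
            have hyO : y ∉ O := fun h => hxy y (Sym2.mem_mk_right x y) h
            have hxF : x ∈ F := by
              rcases Finset.mem_union.1 hx with h | h
              · exact hSF h
              · exact (Finset.mem_sdiff.1 h).1
            have hyF : y ∉ F := fun h => hyFS (Finset.mem_sdiff.2 ⟨h, hyS⟩)
            exact hcl x (Finset.mem_union_right O hxF) y hyO hyF hyA
        have hrel' : ∀ a ∈ A, (prodBernoulli (fun e : Sym2 (Fin n) =>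
            if (∀ x ∈ e, x ∈ S) ∧ ¬ e.IsDiag then 1 else k e)).real (openConn a b)ᶜ ≤ c :=
          fun a ha => hsub S a ha
        have hIH := IH k S (F \ S) c hcard hSA' hFA' hSF' hcl' hrel'
        -- `hIH : (α S - β S) ^ (|F \ S| + 1) ≤ c`
        have hexp : (F \ S).card + 1 ≤ F.card := hcard
        calc (α S - β S) ^ F.card ≤ (α S - β S) ^ ((F \ S).card + 1) :=
              pow_le_pow_of_le_one h0 h1 hexp
          _ ≤ c := hIH
  -- the largest term
  have hex : ∃ S ∈ (Finset.univ : Finset (Finset (Fin n))), ℓ S ≠ 0 := by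
    by_contra hcon
    push Not at hcon
    have : ∑ S : Finset (Fin n), ℓ S = 0 := Finset.sum_eq_zero fun S _ => hcon S (Finset.mem_univ _)
    rw [hone] at this
    exact one_ne_zero this
  obtain ⟨S₀, hS₀, hS₀max⟩ := Finset.exists_max_image
    ((Finset.univ : Finset (Finset (Fin n))).filter fun S => ℓ S ≠ 0) (fun S => α S - β S)
    (by obtain ⟨S, -, hS⟩ := hex; exact ⟨S, Finset.mem_filter.2 ⟨Finset.mem_univ _, hS⟩⟩)
  have hS₀ne : ℓ S₀ ≠ 0 := (Finset.mem_filter.1 hS₀).2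
  set γ : ℝ := α S₀ - β S₀ with hγ
  obtain ⟨hγ0, -, hγc⟩ := hterm S₀ hS₀ne
  -- `bad ≤ γ`
  have hbad_le : (prodBernoulli g).real (⋃ o ∈ O, ⋃ x ∈ A, openConn o x) -
      (prodBernoulli g).real (⋃ o ∈ O, openConn o b) ≤ γ := by
    rw [hAsum, hbsum, ← Finset.sum_sub_distrib]
    have heq : ∑ S : Finset (Fin n), (ℓ S * α S - ℓ S * β S) =
        ∑ S : Finset (Fin n), ℓ S * (α S - β S) :=
      Finset.sum_congr rfl fun S _ => by ring
    rw [heq]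
    refine pocketGlue_convex_le Finset.univ ℓ (fun S => α S - β S) γ
      (fun S _ => measureReal_nonneg) hone fun S _ hS => ?_
    exact hS₀max S (Finset.mem_filter.2 ⟨Finset.mem_univ _, hS⟩)
  have hbad0 : 0 ≤ (prodBernoulli g).real (⋃ o ∈ O, ⋃ x ∈ A, openConn o x) -
      (prodBernoulli g).real (⋃ o ∈ O, openConn o b) := by
    have := measureReal_mono (μ := prodBernoulli g) (pocketGlue_reach_b_subset O A hbA)
      (measure_ne_top _ _)
    linarith
  -- assemble
  have hpow : ((prodBernoulli g).real (⋃ o ∈ O, ⋃ x ∈ A, openConn o x) -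
      (prodBernoulli g).real (⋃ o ∈ O, openConn o b)) ^ F.card ≤ c :=
    le_trans (pow_le_pow_left₀ hbad0 hbad_le F.card) hγc
  calc ((prodBernoulli g).real (⋃ o ∈ O, ⋃ x ∈ A, openConn o x) -
          (prodBernoulli g).real (⋃ o ∈ O, openConn o b)) ^ F.card *
        (prodBernoulli g).real {ω : BondConfig (Fin n) | ∀ o ∈ O, ω ∉ openConn o b}
      ≤ c * (prodBernoulli g).real {ω : BondConfig (Fin n) | ∀ o ∈ O, ω ∉ openConn o b} :=
        mul_le_mul_of_nonneg_right hpow measureReal_nonneg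
    _ ≤ t := htrans

/-! ### The registered statements -/

/-- **Pocket-size gluing, block form** (registered stub `pocketSizeGluing_block` of crux
stmt-CriticalPhenomena-4575, line `bhk-superadditivity-thinning`).  For a contracted observer block `O`
(`glue w O`), a relay set `A ∋ b` disjoint from `O`, and a free region `F` (disjoint from `O` and `A`)
such that every positive-weight pair leaving `O ∪ F` ends in `O ∪ F ∪ A`: if `μ(a ↮ b) ≤ t` for all
`a ∈ A` then `(μ(O ↔ A) − μ(O ↔ b)) ^ (|F| + 1) ≤ t`, and for `F ≠ ∅` the stronger
`(μ(O ↔ A) − μ(O ↔ b)) ^ |F| · μ(∀ o ∈ O, o ↮ b) ≤ t`.  Strong induction on `|F|`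
(`pocketGlue_base`, `pocketGlue_step`). -/
theorem pocketSizeGluing_block : ∀ (n : ℕ) (w : Sym2 (Fin n) → unitInterval) (O F A : Finset (Fin n)) (b : Fin n) (t : ℝ), b ∈ A → Disjoint O A → Disjoint F A → Disjoint O F → (∀ x ∈ O ∪ F, ∀ y : Fin n, y ∉ O → y ∉ F → y ∉ A → w s(x, y) = 0) → (∀ a ∈ A, (Literature.Probability.LatticeModels.prodBernoulli (fun e : Sym2 (Fin n) => if (∀ x ∈ e, x ∈ O) ∧ ¬ e.IsDiag then 1 else w e)).real (Literature.Probability.Percolation.openConn a b)ᶜ ≤ t) → ((Literature.Probability.LatticeModels.prodBernoulli (fun e : Sym2 (Fin n) => if (∀ x ∈ e, x ∈ O) ∧ ¬ e.IsDiag then 1 else w e)).real (⋃ o ∈ O, ⋃ x ∈ A, Literature.Probability.Percolation.openConn o x) - (Literature.Probability.LatticeModels.prodBernoulli (fun e : Sym2 (Fin n) => if (∀ x ∈ e, x ∈ O) ∧ ¬ e.IsDiag then 1 else w e)).real (⋃ o ∈ O, Literature.Probability.Percolation.openConn o b)) ^ (F.card + 1) ≤ t ∧ (F.Nonempty → ((Literature.Probability.LatticeModels.prodBernoulli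 (fun e : Sym2 (Fin n) => if (∀ x ∈ e, x ∈ O) ∧ ¬ e.IsDiag then 1 else w e)).real (⋃ o ∈ O, ⋃ x ∈ A, Literature.Probability.Percolation.openConn o x) - (Literature.Probability.LatticeModels.prodBernoulli (fun e : Sym2 (Fin n) => if (∀ x ∈ e, x ∈ O) ∧ ¬ e.IsDiag then 1 else w e)).real (⋃ o ∈ O, Literature.Probability.Percolation.openConn o b)) ^ F.card * (Literature.Probability.LatticeModels.prodBernoulli (fun e : Sym2 (Fin n) => if (∀ x ∈ e, x ∈ O) ∧ ¬ e.IsDiag then 1 else w e)).real {ω : Literature.Probability.Percolation.BondConfig (Fin n) | ∀ o ∈ O, ω ∉ Literature.Probability.Percolation.openConn o b} ≤ t) := by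
  intro n w O F A b t hbA hOA hFA hOF hcl hrel
  -- strong induction on `F.card`, for all blocks / weights / slacks on the same vertex set
  suffices H : ∀ (m : ℕ) (w : Sym2 (Fin n) → unitInterval) (O F : Finset (Fin n)) (t : ℝ), F.card = m →
      Disjoint O A → Disjoint F A → Disjoint O F →
      (∀ x ∈ O ∪ F, ∀ y : Fin n, y ∉ O → y ∉ F → y ∉ A → w s(x, y) = 0) →
      (∀ a ∈ A, (prodBernoulli (fun e : Sym2 (Fin n) =>
        if (∀ x ∈ e, x ∈ O) ∧ ¬ e.IsDiag then 1 else w e)).real (openConn a b)ᶜ ≤ t) →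
      ((prodBernoulli (fun e : Sym2 (Fin n) => if (∀ x ∈ e, x ∈ O) ∧ ¬ e.IsDiag then 1 else w e)).real
            (⋃ o ∈ O, ⋃ x ∈ A, openConn o x) -
          (prodBernoulli (fun e : Sym2 (Fin n) => if (∀ x ∈ e, x ∈ O) ∧ ¬ e.IsDiag then 1 else w e)).real
            (⋃ o ∈ O, openConn o b)) ^ (F.card + 1) ≤ t ∧
        (F.Nonempty →
          ((prodBernoulli (fun e : Sym2 (Fin n) => if (∀ x ∈ e, x ∈ O) ∧ ¬ e.IsDiag then 1 else w e)).real
                (⋃ o ∈ O, ⋃ x ∈ A, openConn o x) -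
              (prodBernoulli (fun e : Sym2 (Fin n) =>
                if (∀ x ∈ e, x ∈ O) ∧ ¬ e.IsDiag then 1 else w e)).real
                (⋃ o ∈ O, openConn o b)) ^ F.card *
            (prodBernoulli (fun e : Sym2 (Fin n) => if (∀ x ∈ e, x ∈ O) ∧ ¬ e.IsDiag then 1 else w e)).real
              {ω : BondConfig (Fin n) | ∀ o ∈ O, ω ∉ openConn o b} ≤ t) from
    H F.card w O F t rfl hOA hFA hOF hcl hrel
  intro m
  induction m using Nat.strong_induction_on with
  | _ m IHm =>
    intro w O F t hm hOA hFA hOF hcl hrel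
    have hbO : b ∉ O := fun h => Finset.disjoint_left.1 hOA h hbA
    -- `bad ≤ u`
    have hbad_le_u : (prodBernoulli (fun e : Sym2 (Fin n) =>
          if (∀ x ∈ e, x ∈ O) ∧ ¬ e.IsDiag then 1 else w e)).real (⋃ o ∈ O, ⋃ x ∈ A, openConn o x) -
        (prodBernoulli (fun e : Sym2 (Fin n) =>
          if (∀ x ∈ e, x ∈ O) ∧ ¬ e.IsDiag then 1 else w e)).real (⋃ o ∈ O, openConn o b) ≤
        (prodBernoulli (fun e : Sym2 (Fin n) => if (∀ x ∈ e, x ∈ O) ∧ ¬ e.IsDiag then 1 else w e)).real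
          {ω : BondConfig (Fin n) | ∀ o ∈ O, ω ∉ openConn o b} := by
      rw [pocketGlue_forall_notMem_eq, probReal_compl_eq_one_sub (pocketGlue_measurableSet _)]
      linarith [measureReal_le_one (μ := prodBernoulli (fun e : Sym2 (Fin n) =>
        if (∀ x ∈ e, x ∈ O) ∧ ¬ e.IsDiag then 1 else w e)) (s := ⋃ o ∈ O, ⋃ x ∈ A, openConn o x)]
    have hbad0 : 0 ≤ (prodBernoulli (fun e : Sym2 (Fin n) =>
          if (∀ x ∈ e, x ∈ O) ∧ ¬ e.IsDiag then 1 else w e)).real (⋃ o ∈ O, ⋃ x ∈ A, openConn o x) -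
        (prodBernoulli (fun e : Sym2 (Fin n) =>
          if (∀ x ∈ e, x ∈ O) ∧ ¬ e.IsDiag then 1 else w e)).real (⋃ o ∈ O, openConn o b) := by
      have := measureReal_mono (μ := prodBernoulli (fun e : Sym2 (Fin n) =>
        if (∀ x ∈ e, x ∈ O) ∧ ¬ e.IsDiag then 1 else w e)) (pocketGlue_reach_b_subset O A hbA)
        (measure_ne_top _ _)
      linarith
    by_cases hF : F = ∅
    · subst hF
      refine ⟨?_, fun h => absurd h Finset.not_nonempty_empty⟩
      rw [Finset.card_empty, zero_add, pow_one]
      refine pocketGlue_base w O A b t hbA hOA (fun x hx y hyO hyA => ?_) hrel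
      exact hcl x (by simpa using hx) y hyO (Finset.notMem_empty y) hyA
    · have hFne : F.Nonempty := Finset.nonempty_iff_ne_empty.2 hF
      have hstrong := pocketGlue_step w O F A b t hbA hOA hFA hFne hcl hrel
        (fun w' O' F' t' hlt hO'A hF'A hO'F' hcl' hrel' =>
          (IHm F'.card (hm ▸ hlt) w' O' F' t' rfl hO'A hF'A hO'F' hcl' hrel').1)
      refine ⟨?_, fun _ => hstrong⟩
      rw [pow_succ]
      exact le_trans (mul_le_mul_of_nonneg_left hbad_le_u (pow_nonneg hbad0 _)) hstrong

end

end Summit.CriticalPhenomena.PercolationContinuityZ3.Theorems
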